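import Mathlib
import Summits.Ventures.PercRepro2.SwOutMixedArmsBaseDual

/-!
# The several-arms base: the abstract leak is the geometric leak (blind cell PercRepro2, night-4
g20, 2026-08-27; proofs/NIGHT4-G20.md §4′ / §4″)

The leak predicate of the abstract lemma (`MixedArms.Leak`: some arm leaks, `LeakArm`) is the
disjunction of the red-side leak `LeakRR` (the hypothesis of the red hull formula) and the
blue-side leak `LeakBR` (its dual): `leak_iff`.  Hence the non-leaking block of the abstract lemma
is exactly the set of points where both hull formulas hold (`not_leak_iff_RB`).  The twin of g18's
`leak'_iff` for several arms.
-/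

namespace Summit.Ventures.PercRepro2

namespace MixedArms

variable {ι ρ ν κ : Type*} {arm : ν → ρ}

/-- **The abstract leak is the red-side or the blue-side leak.** -/
theorem leak_iff {q : PtR ι ρ ν κ} : Leak q arm ↔ LeakRR arm q ∨ LeakBR arm q := by
  obtain ⟨s, a, uP, e, f⟩ := q
  simp only [Leak, LeakArm, LeakRR, LeakBR, flipPt, flipAll, Bool.not_eq_true', Bool.not_eq_false']
  constructor
  · rintro ⟨r, ⟨hs, huP, h3⟩ | ⟨hs, huP, h3⟩⟩
    · exact Or.inl ⟨hs, r, huP, h3⟩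
    · exact Or.inr ⟨hs, r, huP, h3⟩
  · rintro (⟨hs, r, huP, h3⟩ | ⟨hs, r, huP, h3⟩)
    · exact ⟨r, Or.inl ⟨hs, huP, h3⟩⟩
    · exact ⟨r, Or.inr ⟨hs, huP, h3⟩⟩

/-- The non-leaking points are those without red-side and without blue-side leak. -/
theorem not_leak_iff_RB {q : PtR ι ρ ν κ} : ¬ Leak q arm ↔ ¬ LeakRR arm q ∧ ¬ LeakBR arm q := by
  rw [leak_iff, not_or]

end MixedArms

end Summit.Ventures.PercRepro2
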